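import Mathlib
import HarnessLib
import HarnessLib.Audit
import Summits.QuantumFields.Statement
import Summits.QuantumFields.YangMills.Theorems.WeakCouplingRates
import Summits.QuantumFields.YangMills.Theorems.WeakCouplingRatesCurvatureCorrPowerFloor
import Summits.QuantumFields.YangMills.Theorems.WeakCouplingRatesColdBoxTwoPointFloorW
import Literature.MathematicalPhysics.QuantumLattice.GaugeGroups
import HarnessLib.Audit.Status.Attr

/-!
Route: AllWindowsColdBox

# Route AllWindowsColdBox — cold-box Gaussian domination at EVERY polynomial window (small-field RG
only) gives ξ ≥ β^A for every A (proposed rung XiSuperPolySU2)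

X = BOX∀ ∧ BULK∃ ("it suffices to show"), a LINE on a PROPOSED rung R2ξ″ `XiSuperPolySU2 := ∀ A > 0,
MassGapPowerDecayOf 4 (SU(2), fundamental) A`
(«the correlation length of 4-D SU(2) lattice Yang–Mills exceeds every power of β»: for every A and
all large β no torus-limit state has an
RP-spectral gap ≥ β^(−A)); it sits strictly between the PROVED leaf R2ξ `XiPowSU2` (∃ ε;
`xiPowSU2_of_xiSuperPoly` in the sketch) and
asymptotic-freedom scaling ξ ≍ e^{cβ}, and is NOT the Clay gap. BOX∀ (`BoxAllWindowsSU2`): for ALL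
exponents 0 < A < θ the flat-wall cold box
of side 2⌈β^θ⌉+1 has β²·(plaquette covariance at separation ⌈β^A⌉) ≥ c·C(⌈β^A⌉)² for large β — the
proved one-scale statement
`ColdBoxTwoPointFloorW` WITHOUT its exponent ceiling θ₀ = 1/100. BULK∃ (`BulkAllWindowsSU2`): for
every A > 0 SOME box exponent θ > A transfers
(torus-limit covariance ≥ η·box covariance, eventually in the volume). With the tree's group-free
FLOOR and the generic glue
`massGapPowerDecayOf_of_box` at (2A, θ) this yields `XiSuperPolySU2`. The target is the route's own
rung item (DRAFT by design until
director-ym registers R2ξ″); no summit is proved by this line.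
Lean: `Summit.QuantumFields.YangMills.Theses.AllWindowsColdBox.BoxAllWindowsSU2 ∧
Summit.QuantumFields.YangMills.Theses.AllWindowsColdBox.BulkAllWindowsSU2`

## Assembly
Pure logic plus two tree theorems: given A > 0 take θ > 2A and BULK at (2A, θ) from
BulkAllWindowsSU2, c > 0 and BOX at (2A, θ) from
BoxAllWindowsSU2; `massGapPowerDecayOf_of_box ρ continuous_fundamentalRep (0 < 2A) hc hbox hbulk
curvatureCorrPowerFloor_proof` gives
`MassGapPowerDecayOf 4 ρ (2A/2) = … A`. Kernel-checked as `closes` in glue2.lean / Sketch2.lean (rc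
0, no sorry). The deciding theorem concludes
the route's own rung item `XiSuperPolySU2` BY NAME (rung shape: DRAFT vs the summit until
director-ym registers R2ξ″; then
`route edit --closes-target
Summit.QuantumFields.YangMills.Theses.AllWindowsColdBox.XiSuperPolySU2`).

Rationale: WHY THIS LINE. Open-question harvest: Chatterjee (arXiv:2401.10507 §3.5; Problem 5.1 of
arXiv:1602.01222 / ICM 2018 survey) asks for the ORDER of the
correlation length at weak coupling; the tree now proves ξ ≥ β^ε for SU(2) (R2ξ, 2026-08-27) by a
ONE-scale cold-box Laplace expansion whose
error β^{cθ−1} caps the box at side β^{1/100}. Removing the ceiling is exactly a MULTI-SCALE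
statement, and at POLYNOMIAL scales it needs
only the SMALL-FIELD half of Bałaban's renormalisation group (Balaban1983PropagatorsI/II,
Balaban1985Averaging, Balaban1985PropagatorsLattice,
Balaban1987RG1): in a box of side β^θ large fields (a plaquette with cost > β^{−1+2δ}) have
probability ≤ β^{4θ}·e^{−cβ^{2δ}} by the Gibbs
union bound already landed for the one-scale proof (`ymSpecification_one_real_le`), so NO
large-field R-operation and NO continuum limit is
required — the running coupling at scale β^A is β⁻¹(1 + O(A log β/β)). What it does that listed
routes do not: WeakCouplingRates (R2ξ) is one
scale; BalabanLadder/BalabanUVNodes (R4) run the FULL RG (large fields, ε → 0) toward UV stability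
of the partition function and never
conclude a correlation-length statement; ColdBoxAllGroups / AllGroupsColdBox (tonight) vary the
group at one scale. This line isolates
«small-field multi-scale Gaussian domination in a cold polynomial box» as sufficient for a physical
rung (superpolynomial ξ) — a rung the
ladder lacks between R2ξ and R4. Imported area: constructive RG (Bałaban;
Gawedzki–Kupiainen/Brydges-style finite-range decompositions as
alternatives for the Gaussian fluctuation steps).

RANKED CRUXES. #0 XiSuperPolySU2 (target) — for every A > 0 and all large β, no infinite-volume
torus-limit state of 4-D SU(2) Wilson lattice gauge theory (fundamental representation) has an
RP-spectral mass gap ≥ β^(−A) (`MassGapPowerDecayOf 4 ρ A` for every A) — proposed rung R2ξ″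
«XI-SUPERPOLY». [deps: BoxAllWindowsSU2, BulkAllWindowsSU2] [difficulty: XL] (why it might fail: it
does not fail physically (asymptotic freedom predicts ξ ≍ β^{c₁}e^{c₂β}); as a rung it fails only if
no multi-scale control short of the full Bałaban programme exists, i.e. if BOX∀ is as hard as R4.)
[arXiv:2401.10507, arXiv:1602.01222, Balaban1987RG1]
#2 BoxAllWindowsSU2 (crux) — for ALL exponents 0 < A < θ there is c > 0 with `BoxTwoPointDomination
(SU(2), fundamental) A θ c`: in the flat-wall axial-gauge box of half-side ⌈β^θ⌉, β²·boxPlaqCov at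
time separation ⌈β^A⌉ ≥ c·curvaturePlaquetteCorr(⌈β^A⌉)² for all large β (the proved
`ColdBoxTwoPointFloorW` is the sub-case θ ≤ 1/100). [difficulty: XL] (why it might fail: for θ ≥ 1/2
the axial gauge degenerates (links random-walk to distance β^{θ−1/2} from 1), so domination needs
Bałaban's averaging gauges and ≈ θ·log₂β fluctuation steps with β-uniform small-field control; the
small-field RG may not separate from the large-field machinery.) [Balaban1985Averaging,
Balaban1985PropagatorsLattice, Balaban1987RG1, BrydgesFrohlichSeiler1979, Chatterjee2016]
#3 BulkAllWindowsSU2 (crux) — for every A > 0 there is a box exponent θ > A with `BulkDominatesBox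
(SU(2), fundamental) A θ`: some η > 0 such that for large β, eventually in the volume L, the torus
plaquette covariance at separation ⌈β^A⌉ is ≥ η × the cold-box covariance of half-side ⌈β^θ⌉ (the
proved `BulkDominatesColdBoxW` supplies such (A, θ) only under small ceilings). [difficulty: XL]
(why it might fail: DLR over a box of side β^θ, θ > A large, needs good-boundary covariance
stability at multi-scale precision (relative o(1) on a signal β^{−2−8A}) for non-flat small boundary
data — Bałaban's RG with boundary conditions (UV-stability barrier); the conditional-mean term may
need θ ≫ A.) [FrohlichIsraelLiebSimon1978, Balaban1985Averaging, Balaban1989LargeFieldII,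
DriesslerLandauPerez1979]

TWO-LAYER PLAN. Foreseen glued splits (not filed now): BoxAllWindowsSU2 ⇐
BoxGaussianDominationAllWindows (the tree's S3c `stub_boxGaussianDomination` with the
ceiling removed: |β²·boxPlaqCov − ¾·boxCircSqCov| ≤ ½·boxMaxwellPlaqCov² for all 0 < A < θ) composed
with the LANDED all-exponent Gaussian stubs
S3a `stub_boxGaussianWick` and S4 `stub_boxKernelVsLattice` (birth skeleton
bc/BoxAllWindowsSU2_birth.lean); below it, per-scale children
«one Bałaban averaging step preserves Gaussian domination of the plaquette two-point function up to
(1 + O(β⁻¹ log))» (the induction step) and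
«k-step composition at k = ⌈θ log₂ β⌉». BulkAllWindowsSU2 ⇐ the dlr-chessboard children of
`BulkDominatesColdBoxW` (largeFieldRarity p445862 and
dlrAssembly p448414 are window-free in form; GoodBoundaryCovStable / GoodBoundaryMeanSmooth at θ =
2A + 1 are the new children).

KILL CRITERIA. A proof that BoxTwoPointDomination fails at some window (A, θ) with θ large (e.g. the
flat-wall box covariance at separation β^A is
o(β⁻²C²) once θ ≥ 1/2 because axial-gauge infrared fluctuations genuinely change the plaquette
covariance) closes the route
`refuted:BoxAllWindowsSU2` and refutes the mechanism; a proof that for some A no θ > A admits bulk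
transfer kills BULK∃ and forces a DLR-free
transfer or retirement. If the full R4 `UV` lands first with correlation control, the rung is
superseded.

NOT DECOMPOSED YET. The per-scale induction statement (which gauge, which small-field norm, which
polynomial loss per step), the choice θ(A) in BULK∃, and all
constants are left to the provers; the Gaussian children S3a/S4 are already landed for all
exponents, so every open child is an interacting-measure statement.

CHEAPEST FALSIFIER. Two-scale window by hand: take θ ∈ (1/100, 1/50] and check whether ONE
block-averaging step (Bałaban 1985, L = 2) followed by the landed one-scale
engine at the coarse scale reproduces |β²·boxPlaqCov − ¾·boxCircSqCov| ≤ ½Π² with an error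
β^{c(θ/2)−1}·(1 + O(β⁻¹ log β)); if the averaging step's
remainder is not relatively o(1) on the connected covariance (signal β^{−2−8A}) the induction cannot
start and the line is dead. Instrument row:
I3-type certified Gaussian two-scale box two-point (kit) at (θ, A) = (0.02, 0.01) vs (0.3, 0.1), β =
10³ — ratio to ¾·boxCircSqCov within 5%.

NUMBERS. One-scale ceiling of record θ₀ = 1/100 (stub S3c, `stub_boxGaussianDomination`), ε = A/2 <
1/200 in `xiPowSU2_holds`; S4 ratio box/lattice kernel
≥ 0.9885 at T ≤ H/2 (kit j244532, all exponents); large-field union bound β^{4θ}·exp(−cβ^{2δ}) → 0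
for every θ; running coupling at scale β^A:
β_eff⁻¹ = β⁻¹(1 + (11/6π²)·A·log β/β + …) for SU(2).

DEFINITION REQUESTS. None (all objects are the tree's WeakCouplingRates currency: boxPlaqCov,
BoxTwoPointDomination, BulkDominatesBox, MassGapPowerDecayOf).

Novelty: Searches (2026-08-27): `ledger route closers --problem QuantumFields` (9 leaves: no
superpolynomial/all-power ξ leaf; XiPow all-G being loaded as
R2xi-G per director-ym R335); tree `rg "MassGapPowerDecayOf|PolySeparationPlaquetteFloor|XiPow"`
(only ∃ε forms; no ∀A statement); `ledger negatives
--problem QuantumFields` (no box/bulk/ξ statement refuted); lit search "correlation length lattice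
gauge weak coupling lower bound renormalization group"
and `--hybrid` (held: Chatterjee2016, BrydgesFrohlichSeiler1979, Balaban CMP series typed under
Literature/…/Balaban1983to89); lit frontier QuantumFields
--since 2024 (rate-limited, 0 rows); galaxy "small field|block spin gauge" (0 usable hits).
Nearest prior art found: route-QuantumFields-WeakCouplingRates (one-scale, ceiling θ₀, PROVED);
Bałaban, CMP 109 (1987) RG1 small-field effective
actions (Literature/MathematicalPhysics/QuantumFieldTheory/Balaban1983to89/*); Chatterjee
arXiv:1602.01222 §16 (one-scale Gaussian approximation).
Delta: the rung «ξ superpolynomial» and its reduction to SMALL-FIELD-ONLY multi-scale Gaussian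
domination in a cold polynomial box (large fields
and the continuum limit provably unnecessary at polynomial scales) are not in the tree, the ladder,
or the held literature.
Claimed grade: new-combination  [refs: 1602.01222, Chatterjee2016, BrydgesFrohlichSeiler1979]

Barriers (technique_class: multiscale-gaussian-domination, small-field-rg): - technique_class: multiscale-gaussian-domination, small-field-rg
- Literature.Barriers.QuantumFields.PerturbativeInvisibility: outside — both cruxes are LOWER bounds
on covariances at polynomial separations β^A ≪ e^{cβ}, where perturbation theory (running coupling
β⁻¹(1+O(log/β))) is the truth; no claim at the confinement scale.
- Literature.Barriers.QuantumFields.UVStabilityNonUniqueness: BulkAllWindowsSU2 sits inside its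
class (comparison of finite-volume states across a boundary); evaded by DLR at ONE polynomial box
per A with chessboard rarity and no uniqueness / no ε → 0 claim; BoxAllWindowsSU2 is a single
finite-volume flat-wall state (outside).
- Literature.Barriers.QuantumFields.ToronPlaneAnticorrelation: does not bite — flat-wall boxes carry
no torons; the torus enters only through BULK's DLR average at separation β^A ≪ L, eventually in L.
- Negatives index: empty for box/bulk/ξ statements (ledger negatives --problem QuantumFields,
2026-08-27T21:10Z); discrete-subgroup freezing n/a (SU(2) continuous); the unitary Haar small-ball
bound is a resource (large-field thresholds β^{−1+2δ}).

History (route lifecycle, newest last):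
- 2026-08-27T21:31:39Z · rev 1: restated BulkAllWindowsSU2 (stmt-QuantumFields-22806) — critic idea-crit-4 P2 (21:23:07Z): bound BULK's θ explicitly (A < θ ≤ 7A); BOX restate to θ ≤ 7A follows in the next edit; BC7 CLEAN 4/4, BC2 12/12 FAIL on the (planner-ym-idea-2-g0-0)
- 2026-08-27T21:31:47Z · rev 1: restated BoxAllWindowsSU2 (stmt-QuantumFields-22805) — critic idea-crit-4 P2 (21:23:07Z): weaken BOX∀ to the window A < θ ≤ 7A matched to BULK's (edit tk-1afbe5737592); same Assembly; BC7 CLEAN 4/4, BC2 12/12 FAIL o (planner-ym-idea-2-g0-0)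
- 2026-08-27T22:04:04Z · rev 2: restated Assembly (stmt-QuantumFields-22807) — repair of the restate race (tk-1afbe5737592 rolled back while tk-e2ffa1a205c0 landed BOX v1 as a second decl BoxAllWindowsSU22 = stmt-QuantumFields-22910): drop (planner-ym-idea-2-g0-0)
- 2026-08-27T22:04:04Z · rev 2: dropped BoxAllWindowsSU2, BulkAllWindowsSU2 — repair of the restate race (tk-1afbe5737592 rolled back while tk-e2ffa1a205c0 landed BOX v1 as a second decl BoxAllWindowsSU22 = stmt-QuantumFields-22910): drop (planner-ym-idea-2-g0-0)

sub-problem: YangMills · status: draft · opened planner-ym-idea-2-g0-0 2026-08-27T21:18:49Z · rev 7 · ledger route-QuantumFields-AllWindowsColdBox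
GENERATED by the gate from the ledger (D-0016/17). Provers cite these decls: `theorem foo : Summit.QuantumFields.YangMills.Theses.AllWindowsColdBox.<Decl> := …` in Summits/QuantumFields/YangMills/Theorems/<Name>.lean.
-/

namespace Summit.QuantumFields.YangMills.Theses.AllWindowsColdBox

open scoped BigOperators Topology Manifold Classical MeasureTheory ProbabilityTheory Matrix InnerProductSpace ComplexConjugate ContinuousMap
open Filter Set Function TopologicalSpace MeasureTheory

attribute [summit_statement] _root_.YangMills

/-- item stmt-QuantumFields-22910 · crux · rank 2 · SPLIT (gen 1) into BoxMidWindowsSU22, BoxHighWindowsSU22 + glue BoxAllWindowsSU22OfWindows · direct attempts still welcome (low priority) · by planner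
why it might fail: for A ≥ 1/14 the box β^{7A} exceeds β^{1/2}: the complete axial gauge degenerates and the small-field multi-scale expansion must separate cleanly from large fields at every one of ≈ 7A·log₂β scales — the untested bet of the line
sources: Balaban1985b, arXiv:1602.01222, Chatterjee2024ScalingLimit
BOX (critic P2 restatement, v1): for all exponents 0 < A < θ ≤ 7A the flat-wall cold box of side
2⌈β^θ⌉+1 has β²·(plaquette covariance at separation ⌈β^A⌉) ≥ c·C(⌈β^A⌉)², eventually in β — the
PROVED one-scale ColdBoxTwoPointFloorW with its ceiling θ₀ = 1/100 replaced by the linear window θ ≤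
7A (box polynomially tied to the separation, never an infinite-volume statement); content =
small-field multi-scale Gaussian domination (≈ θ·log₂β Bałaban averaging steps in a Dirichlet box,
large fields by the landed Gibbs union bound, no ε→0). -/
@[route_item "route-QuantumFields-AllWindowsColdBox", crux]
def BoxAllWindowsSU22 : Prop :=
  ∀ A θ : ℝ, 0 < A → A < θ → θ ≤ 7 * A → ∃ c : ℝ, 0 < c ∧ Summit.QuantumFields.YangMills.Theorems.WeakCouplingRates.BoxTwoPointDomination (G := Matrix.specialUnitaryGroup (Fin 2) ℂ) (Literature.MathematicalPhysics.QuantumLattice.fundamentalRep (Fin 2)) A θ c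

-- parent: BoxAllWindowsSU22 · child (gen 1)
/--     item stmt-QuantumFields-24003 · crux · rank 201 · closed · proved by Summit.QuantumFields.YangMills.Theorems.AllWindowsColdBoxBoxMidLine.BoxMidWindowsSU22_proof (prover)
    parent: BoxAllWindowsSU22 · by planner
    why it might fail: The temporal-gauge Dirichlet covariance may have ℓ¹-norm ≫ H² (axial-gauge infrared growth along the time direction), and cell-wise large-field extraction for unbounded Lie-algebra charts may reintroduce H⁴-type combinatorial factors, shrinking the convergent one-scale window below θ = 1/16.
    sources: Balaban1987RG1, Brydges1986, Rivasseau1991, KoteckyPreiss1986, tree:Summits/QuantumFields/YangMills/Theorems/WeakCouplingRatesColdBoxTwoPointFloorWStubBoxGaussianDomination.lean (boxDirichletDominationAbs, eventually_smallness: 40θ<1/2)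
[crux · LINE-16 mid window] the parent `BoxAllWindowsSU22` restricted to box exponents θ ≤ 1/16.
WHY: the tree settles θ ≤ 1/100 (`boxDirichletDominationAbs`, θ₀ = 1/100) by a GLOBAL tilt bound
whose smallness condition is `40θ < 1/2` (`eventually_smallness`: the term β^(5θ−1/2)·(β^θ)^35),
i.e. that METHOD is capped at θ < 1/80; a LOCALISED one-scale cluster expansion
(Brydges–Kennedy/BKAR forest formula around the Dirichlet Gaussian `boxDirichlet^{⊗3}` in the
temporal-forest gauge, cubic vertex g = β^(−1/2), large fields excluded cell-wise) has expansion
parameter g·Σ_{y∈box}|C_Dir(x,y)| ≍ β^(−1/2)·H²·log H for H = β^θ, convergent for θ < 1/4 — so the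
honest one-scale window is θ < 1/4, not 1/100, and 1/16 sits inside it with margin (even
H³-summability suffices). Obligation behind it (the line's stub, typed in the ideator's Sketch as
`BoxDirichletDominationMid`): ∀ θ ∈ (0,1/16], ∃ κ > 8θ, eventually in β, ∀ T ≤ ⌈β^θ⌉₊,
|β²·boxPlaqCov(fund SU(2)) β ⌈β^θ⌉₊ T − (3/4)·boxDirCircSqCov ⌈β^θ⌉₊ T| ≤ β^(−κ); then the tree's
θ₀-agnostic kernel sandwich (`stub_boxGaussianDomination_of_abs`, `boxMaxwellPlaqCov_sandwich`)
gives the window. NOVEL vs listed routes: no open or dead route of the -/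
@[route_item "route-QuantumFields-AllWindowsColdBox"]
def BoxMidWindowsSU22 : Prop :=
  ∀ A θ : ℝ, 0 < A → A < θ → θ ≤ 7 * A → θ ≤ 1 / 16 → ∃ c : ℝ, 0 < c ∧ Summit.QuantumFields.YangMills.Theorems.WeakCouplingRates.BoxTwoPointDomination (G := Matrix.specialUnitaryGroup (Fin 2) ℂ) (Literature.MathematicalPhysics.QuantumLattice.fundamentalRep (Fin 2)) A θ c

-- `BoxMidWindowsSU22` holds: proved by `Summit.QuantumFields.YangMills.Theorems.AllWindowsColdBoxBoxMidLine.BoxMidWindowsSU22_proof` (its module imports this route file, so no `_holds` link can be stated here).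

-- parent: BoxAllWindowsSU22 · child (gen 1)
/--     item stmt-QuantumFields-24004 · crux · rank 202 · open
    parent: BoxAllWindowsSU22 · by planner
    why it might fail: For θ ≥ 1/4 the effective coupling of a box of side β^θ is O(1) at one scale; closing this child as typed requires multi-scale renormalisation of 4D lattice Yang–Mills in a cold box (Bałaban programme territory), which may be as hard as the UV half of the summit.
    sources: Balaban1987RG1, MagnenRivasseauSeneor1993, tree:Summits/QuantumFields/YangMills/Theses/AllWindowsColdBox.lean (parent docstring: multi-scale content)
[crux · LINE-16 residual — the multi-scale wall; do NOT staff before BoxMidWindowsSU22 closes] the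
parent `BoxAllWindowsSU22` restricted to box exponents θ > 1/16: boxes of side β^θ with θ ≥ 1/4 are
beyond any one-scale expansion (g·Σ|C| ≍ β^(2θ−1/2) ≥ 1), so this child is exactly the regime where
a genuine multi-scale (Bałaban-type) analysis of the cold box is needed; θ ∈ (1/16,1/4) is still
one-scale in principle and may migrate into the mid child by a later resplit once the instrument row
I16 fixes k. NOVEL: n/a (honest residual). CHEAPEST FALSIFIER: none cheap — this is the hard core of
R2ξ″ super-polynomial windows. · bears_on: LADDER-YM rung R2ξ″ (RECORD label, zero seats — this line
changes no label and proves no summit; it extends the SETTLED windows of XiSuperPolySU2 from A ≤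
1/8000 toward A ≤ 1/640 and locates where multi-scale genuinely begins) · instrument row: I16 =
growth exponent k of the ℓ¹-norm Σ_{y∈box}|C_Dir(x,y)| of the temporal-forest-gauge Dirichlet box
covariance behind `boxDirCircSqCov` (one-scale cluster window = θ < 1/(2k); k = 2 expected ⇒ θ <
1/4; k = 3 ⇒ θ < 1/6; 1/16 is inside either) · LINE-16 of ideator ym-idea-2 (g11), critic of record
idea-crit-4. -/
@[route_item "route-QuantumFields-AllWindowsColdBox"]
def BoxHighWindowsSU22 : Prop :=
  ∀ A θ : ℝ, 0 < A → A < θ → θ ≤ 7 * A → 1 / 16 < θ → ∃ c : ℝ, 0 < c ∧ Summit.QuantumFields.YangMills.Theorems.WeakCouplingRates.BoxTwoPointDomination (G := Matrix.specialUnitaryGroup (Fin 2) ℂ) (Literature.MathematicalPhysics.QuantumLattice.fundamentalRep (Fin 2)) A θ c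

-- parent: BoxAllWindowsSU22 · glue (gen 1)
/--     item stmt-QuantumFields-24005 · support · rank 203 · closed · proved by Summit.QuantumFields.YangMills.Theorems.AllWindowsColdBox.boxAllWindowsSU22OfWindows_proof (prover)
    parent: BoxAllWindowsSU22 · GLUE: children ⟹ parent · by planner
case split on θ ≤ 1/16: BoxMidWindowsSU22 → BoxHighWindowsSU22 → BoxAllWindowsSU22 (proved in the
ideator's l16/Sketch.lean as boxAllWindowsSU22_of_windows: rcases le_or_gt θ (1/16)) -/
@[route_item "route-QuantumFields-AllWindowsColdBox"]
def BoxAllWindowsSU22OfWindows : Prop :=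
  BoxMidWindowsSU22 → BoxHighWindowsSU22 → BoxAllWindowsSU22

-- `BoxAllWindowsSU22OfWindows` holds: proved by `Summit.QuantumFields.YangMills.Theorems.AllWindowsColdBox.boxAllWindowsSU22OfWindows_proof` (its module imports this route file, so no `_holds` link can be stated here).

/-- item stmt-QuantumFields-24335 · crux · rank 3 · closed · proved by Summit.QuantumFields.YangMills.Theorems.AllWindowsColdBoxBoxHighLine.BoxWindowLowSU2213_proof (prover) · by planner
why it might fail: FP/Haar chart on the Landau ball (S4) may cost H^3·β^{1/2+κ} beyond the convexity budget near θ = 1/13, or the second-order remainder H^4(log H)^m/β (S5) may carry an extra power of H from wall modes of hodgeQ⁻¹ (wall variance 0.43, I20).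
sources: Balaban1985, BrydgesFrohlichSeiler1979, Zwanziger1982
[crux] LOW sub-window (1/16, 1/13] of BoxHighWindowsSU22: one-scale cold-box two-point domination
for SU(2) windows with 1/16 < θ ≤ 1/13 (θ ≤ 7A). Attacked by LINE-19 v5 (7 stubs; skeleton sha16
8d5d2c59aa0fe46a) «landau-sector-relative-bl» (minimal Landau/Hodge gauge sector + RELATIVE currency
boxWindow_of_dirichletDominationRel_ceiling ✓p706506; rung k = 2 reaches θL < 1/12). Critic
idea-crit-4 PASS 2026-08-29T08:05Z. WHY IT MIGHT FAIL: the FP/Haar change of variables on the Landau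
ball (S4) may cost H^3·β^{1/2+κ} beyond the convexity budget for θ near 1/13, or the second-order
remainder H^4(log H)^m/β (S5) may carry an extra power of H from wall modes of hodgeQ^{-1}
(variances 0.43 at walls, I20). SOURCES: Balaban1985, BrydgesFrohlichSeiler1979, Zwanziger1982. -/
@[route_item "route-QuantumFields-AllWindowsColdBox"]
def BoxWindowLowSU2213 : Prop :=
  ∀ A θ : ℝ, 0 < A → A < θ → θ ≤ 7 * A → 1 / 16 < θ → θ ≤ 1 / 13 → ∃ c : ℝ, 0 < c ∧ Summit.QuantumFields.YangMills.Theorems.WeakCouplingRates.BoxTwoPointDomination (G := Matrix.specialUnitaryGroup (Fin 2) ℂ) (Literature.MathematicalPhysics.QuantumLattice.fundamentalRep (Fin 2)) A θ c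

-- `BoxWindowLowSU2213` holds: proved by `Summit.QuantumFields.YangMills.Theorems.AllWindowsColdBoxBoxHighLine.BoxWindowLowSU2213_proof` (its module imports this route file, so no `_holds` link can be stated here).

/-- item stmt-QuantumFields-25580 · crux · rank 4 · open · by planner
why it might fail: hK3/hK4 (third-order cut-set sizes) must be o(β⁻²H⁻⁸) uniformly on the cut small field at κ₃ = 1/8−θ/4; any even piece of tiltU beyond the quadratic vertices bounded only by sup×L² leaves a positive exponent near θ = 1/11 (needs its exact row), and wall modes of hodgeQ⁻¹ may add a power of H.
sources: Balaban1985, BrydgesFrohlichSeiler1979, Zwanziger1982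
[crux] MID sub-window (1/13, 1/11] of BoxWindowHighSU2213 (θ ≤ 7A): one-scale cold-box two-point
domination for SU(2) at the THIRD order of the Landau-sector tilt expansion. Attacked by LINE-20 v4
«landau-rung3» (Cruxes/BoxWindowHighSU2213/Lines/landau_rung3.lean sha16 d9a2874eadb019ee; critic
idea-crit-4 PASS grade B 2026-08-29T13:33Z); by-name closer in the tree modulo the two cut-set size
hypotheses hK3/hK4: LandauRung3.boxWindowMid_of_sizes (✓p754558) over landauThirdOrder_of_sizes₂
(✓p753567). Definitionally equal to AllWindowsColdBoxBoxHighLine.BoxWindowSU22 (1/13) (1/11)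
(Iff.rfl, l27g19/split11_probe.lean). -/
@[route_item "route-QuantumFields-AllWindowsColdBox", crux]
def BoxWindowMidSU221311 : Prop :=
  ∀ A θ : ℝ, 0 < A → A < θ → θ ≤ 7 * A → 1 / 13 < θ → θ ≤ 1 / 11 → ∃ c : ℝ, 0 < c ∧ Summit.QuantumFields.YangMills.Theorems.WeakCouplingRates.BoxTwoPointDomination (G := Matrix.specialUnitaryGroup (Fin 2) ℂ) (Literature.MathematicalPhysics.QuantumLattice.fundamentalRep (Fin 2)) A θ c

/-- item stmt-QuantumFields-24336 · crux · rank 6 · open · by planner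
why it might fail: No one-scale method reaches θ > 1/13: single-scale expansions cap at θ < 1/6 (deterministic ball reduction), the Landau rung ladder at k/(16+4k) < 1/4; closing it needs a genuine RG iteration (Bałaban) = the summit's wall. Declared residual.
sources: Balaban1985, Balaban1983RegularityDecay
[residual — RG/Bałaban class, DECLARED per critic N1] HIGH sub-window θ > 1/13 of
BoxHighWindowsSU22: NOT attacked by LINE-19; it is the multi-scale regime of the HIGH-WINDOWS WALL
memo of record (2026-08-29T07:12Z). Filed so that the split BoxHighWindowsSU22 ⇐ Low ∧ High is
explicit and nobody books LINE-19 as closing ⟨24004⟩. WHY IT MIGHT FAIL: it should not fail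
mathematically (it is implied by the expected mass gap), but no one-scale method reaches it: every
single-scale expansion in the tree caps at θ < 1/6 (deterministic ball reduction) and the Landau
line at k/(16+4k) < 1/4; closing it needs a genuine renormalisation-group iteration (Bałaban), i.e.
the summit's own wall. SOURCES: Balaban1985, Balaban1983RegularityDecay. -/
@[route_item "route-QuantumFields-AllWindowsColdBox", crux]
def BoxWindowHighSU2213 : Prop :=
  ∀ A θ : ℝ, 0 < A → A < θ → θ ≤ 7 * A → 1 / 13 < θ → ∃ c : ℝ, 0 < c ∧ Summit.QuantumFields.YangMills.Theorems.WeakCouplingRates.BoxTwoPointDomination (G := Matrix.specialUnitaryGroup (Fin 2) ℂ) (Literature.MathematicalPhysics.QuantumLattice.fundamentalRep (Fin 2)) A θ c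

/-- item stmt-QuantumFields-25584 · crux · rank 7 · open · by planner
why it might fail: Not expected to fail mathematically, but no one-scale method in the tree reaches θ > 1/11: the Landau rung ladder caps at k/(16+4k) per order k and every third-order exponent budget is infeasible at θ = 1/10; closing it needs a genuine RG iteration (Bałaban) = the summit's own wall.
sources: Balaban1985, Balaban1983RegularityDecay
[residual — RG/Bałaban class, DECLARED] HIGH sub-window θ > 1/11 of BoxWindowHighSU2213: NOT
attacked by LINE-20 (its stub_boxWindowHigh11 is the declared residual U6); the multi-scale regime
of the HIGH-WINDOWS WALL memo. Filed so that the split BoxWindowHighSU2213 ⇐ Mid ∧ High11 is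
explicit (glue parent_of_split kernel-checked, l27g19/split11_probe.lean) and nobody books LINE-20
as closing ⟨24336⟩. Definitionally AllWindowsColdBoxBoxHighLine.BoxWindowHighSU22 (1/11). -/
@[route_item "route-QuantumFields-AllWindowsColdBox", crux]
def BoxWindowHighSU2211 : Prop :=
  ∀ A θ : ℝ, 0 < A → A < θ → θ ≤ 7 * A → 1 / 11 < θ → ∃ c : ℝ, 0 < c ∧ Summit.QuantumFields.YangMills.Theorems.WeakCouplingRates.BoxTwoPointDomination (G := Matrix.specialUnitaryGroup (Fin 2) ℂ) (Literature.MathematicalPhysics.QuantumLattice.fundamentalRep (Fin 2)) A θ c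

/-- item stmt-QuantumFields-22804 · aside · rank 0 · open · by planner
why it might fail: it does not fail physically (asymptotic freedom predicts ξ ≍ β^{c₁}e^{c₂β}); as a rung it fails only if no multi-scale control short of the full Bałaban programme exists, i.e. if BOX∀ is as hard as R4.
sources: arXiv:2401.10507, arXiv:1602.01222, Balaban1987RG1
[target] for every A > 0 and all large β, no infinite-volume torus-limit state of 4-D SU(2) Wilson
lattice gauge theory (fundamental representation) has an RP-spectral mass gap ≥ β^(−A)
(`MassGapPowerDecayOf 4 ρ A` for every A) — proposed rung R2ξ″ «XI-SUPERPOLY». [deps: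
BoxAllWindowsSU2, BulkAllWindowsSU2] [difficulty: XL] -/
@[route_item "route-QuantumFields-AllWindowsColdBox"]
def XiSuperPolySU2 : Prop :=
  ∀ A : ℝ, 0 < A → Summit.QuantumFields.YangMills.Theorems.WeakCouplingRates.MassGapPowerDecayOf (G := Matrix.specialUnitaryGroup (Fin 2) ℂ) 4 (Literature.MathematicalPhysics.QuantumLattice.fundamentalRep (Fin 2)) A

/-- item stmt-QuantumFields-23030 · support · rank 3 · SPLIT (gen 1) into BulkMidWindowSU2, BulkHighWindowSU2 + glue BulkWindowSU2OfWindows · direct attempts still welcome (low priority) · by planner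
[crux] BULK (critic idea-crit-4 P2 restatement v1, replaces BulkAllWindowsSU2 =
stmt-QuantumFields-22806 whose restate ticket tk-1afbe5737592 was rolled back in a render race): for
every exponent A > 0 there is a box exponent θ with A < θ ≤ 7A and BulkDominatesBox (SU(2),
fundamental) A θ — some η > 0 such that for large β, eventually in the torus volume L, the
full-lattice plaquette covariance at separation ⌈β^A⌉ is ≥ η × the flat-wall cold-box covariance of
half-side ⌈β^θ⌉ (DLR + reflection positivity transfer from the Dirichlet box to the bulk; the proved
BulkDominatesColdBoxW gives such (A, θ) only under small ceilings). why it might fail: DLR over a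
box of side β^θ with θ up to 7A needs good-boundary covariance stability at multi-scale precision
(relative o(1) on a signal of size β^{-2-8A}) for non-flat small boundary data, i.e. Balaban RG with
boundary conditions at ≈ 7A·log₂β scales — never published with boundary terms; large-field rarity
must beat the polynomial signal. sources: FrohlichIsraelLiebSimon1978, Balaban1985Averaging,
Balaban1989LargeFieldII, DriesslerLandauPerez1979. [difficulty: XL] -/
@[route_item "route-QuantumFields-AllWindowsColdBox", crux]
def BulkWindowSU2 : Prop :=
  ∀ A : ℝ, 0 < A → ∃ θ : ℝ, A < θ ∧ θ ≤ 7 * A ∧ Summit.QuantumFields.YangMills.Theorems.WeakCouplingRates.BulkDominatesBox (G := Matrix.specialUnitaryGroup (Fin 2) ℂ) (Literature.MathematicalPhysics.QuantumLattice.fundamentalRep (Fin 2)) A θ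

-- parent: BulkWindowSU2 · child (gen 1)
/--     item stmt-QuantumFields-24006 · crux · rank 301 · open
    parent: BulkWindowSU2 · by planner
    why it might fail: Even with cluster domination up to θ = 1/16, the DLR transfer may lose more than the diagonal A = θ/20 at larger boxes (boundary-layer terms of relative size H·β^(−1/2+…) grow with H), so the bulk window could stall below A = 1/320.
    sources: Balaban1987RG1, Brydges1986, tree:Summits/QuantumFields/YangMills/Theorems/AllWindowsColdBoxBulkWindowSU2SmallWindows.lean (bulkWindowSU2_allSmallWindows, A ≤ 1/4000), tree:Summits/QuantumFields/YangMills/Theorems/ColdBoxAllGroupsBulkSmallWindows.lean (boxPlaqCov_le_of_windows)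
[crux · LINE-16 mid window] the parent `BulkWindowSU2` restricted to separation exponents A ≤ 1/320.
WHY: the tree settles A ≤ 1/4000 (`bulkWindowSU2_smallWindows`, witness θ = 2A) through the transfer
diagonal A = θ/20 of `bulkDominatesBox_allGroups_explicit` plus two-box rewindowing
(`boxPlaqCov_le_of_windows`, factor 27), all fed by the GLOBAL-tilt Gaussian domination valid only
for θ ≤ 1/100; the same transfer architecture fed by the one-scale CLUSTER domination up to θ ≤ 1/16
(see BoxMidWindowsSU22: two-sided comparison |β²·boxPlaqCov − (3/4)·boxDirCircSqCov| ≤ β^(−κ) at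
BOTH box sizes θ, θ' ∈ (A, 1/16]) gives BulkDominatesBox A θ on the diagonal A = θ/20 ≤ 1/320 and
then the witness θ = 2A ∈ (A, 7A]. NOVEL vs listed routes: as for BoxMidWindowsSU22 (no route runs a
localised expansion in the cold box; the bulk transfer itself is the tree's). CHEAPEST FALSIFIER:
the instrument row I16 (k ≥ 8 kills θ ≤ 1/16, hence this window); or a check that the DLR/chessboard
transfer constants of `bulkDominatesBox_allGroups_explicit` secretly use θ ≤ 1/100 beyond the
Gaussian-domination input (read `ColdBoxAllGroupsBulkSmallWindows.lean`: the ideator found only the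
domination input window-l -/
@[route_item "route-QuantumFields-AllWindowsColdBox"]
def BulkMidWindowSU2 : Prop :=
  ∀ A : ℝ, 0 < A → A ≤ 1 / 320 → ∃ θ : ℝ, A < θ ∧ θ ≤ 7 * A ∧ Summit.QuantumFields.YangMills.Theorems.WeakCouplingRates.BulkDominatesBox (G := Matrix.specialUnitaryGroup (Fin 2) ℂ) (Literature.MathematicalPhysics.QuantumLattice.fundamentalRep (Fin 2)) A θ

-- parent: BulkWindowSU2 · child (gen 1)
/--     item stmt-QuantumFields-24007 · crux · rank 302 · open
    parent: BulkWindowSU2 · by planner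
    why it might fail: Requires two-point domination in cold boxes of side β^θ with θ beyond the one-scale cluster window (θ ≥ 1/4 eventually), i.e. multi-scale renormalisation of the cold box; may be as hard as the UV stability half of the summit.
    sources: Balaban1987RG1, MagnenRivasseauSeneor1993, tree:Summits/QuantumFields/YangMills/Theses/AllWindowsColdBox.lean
[crux · LINE-16 residual — multi-scale wall; do NOT staff before BulkMidWindowSU2 closes] the parent
`BulkWindowSU2` restricted to A > 1/320: needs box exponents θ > 7·(1/320)… up to O(1), i.e.
Gaussian/cluster control of cold boxes beyond the one-scale window and ultimately multi-scale
analysis. NOVEL: n/a (honest residual). CHEAPEST FALSIFIER: none cheap. · bears_on: LADDER-YM rung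
R2ξ″ (RECORD label, zero seats — this line changes no label and proves no summit; it extends the
SETTLED windows of XiSuperPolySU2 from A ≤ 1/8000 toward A ≤ 1/640 and locates where multi-scale
genuinely begins) · instrument row: I16 = growth exponent k of the ℓ¹-norm Σ_{y∈box}|C_Dir(x,y)| of
the temporal-forest-gauge Dirichlet box covariance behind `boxDirCircSqCov` (one-scale cluster
window = θ < 1/(2k); k = 2 expected ⇒ θ < 1/4; k = 3 ⇒ θ < 1/6; 1/16 is inside either) · LINE-16 of
ideator ym-idea-2 (g11), critic of record idea-crit-4. -/
@[route_item "route-QuantumFields-AllWindowsColdBox"]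
def BulkHighWindowSU2 : Prop :=
  ∀ A : ℝ, 0 < A → 1 / 320 < A → ∃ θ : ℝ, A < θ ∧ θ ≤ 7 * A ∧ Summit.QuantumFields.YangMills.Theorems.WeakCouplingRates.BulkDominatesBox (G := Matrix.specialUnitaryGroup (Fin 2) ℂ) (Literature.MathematicalPhysics.QuantumLattice.fundamentalRep (Fin 2)) A θ

-- parent: BulkWindowSU2 · glue (gen 1)
/--     item stmt-QuantumFields-24008 · support · rank 303 · closed · proved by Summit.QuantumFields.YangMills.Theorems.AllWindowsColdBox.bulkWindowSU2OfWindows_proof (prover)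
    parent: BulkWindowSU2 · GLUE: children ⟹ parent · by planner
case split on A ≤ 1/320: BulkMidWindowSU2 → BulkHighWindowSU2 → BulkWindowSU2 (proved in the
ideator's l16/Sketch.lean as bulkWindowSU2_of_windows: rcases le_or_gt A (1/320)) -/
@[route_item "route-QuantumFields-AllWindowsColdBox"]
def BulkWindowSU2OfWindows : Prop :=
  BulkMidWindowSU2 → BulkHighWindowSU2 → BulkWindowSU2

-- `BulkWindowSU2OfWindows` holds: proved by `Summit.QuantumFields.YangMills.Theorems.AllWindowsColdBox.bulkWindowSU2OfWindows_proof` (its module imports this route file, so no `_holds` link can be stated here).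

-- earlier Assembly (stmt-QuantumFields-22807, replaced 2026-08-27T22:04:04Z -> stmt-QuantumFields-23033): retired by None — Summit.QuantumFields.YangMills.Theses.AllWindowsColdBox.BoxAllWindowsSU2 → Summit.QuantumFields.YangMills.Theses.AllWindowsColdBox.BulkAllWindowsSU2 → Summit.QuantumFields.YangMills.Theses.AllWindowsColdBox.XiSuperPolySU2
/-- item stmt-QuantumFields-23033 · assembly · rank 1 · closed · proved by Summit.QuantumFields.YangMills.Theorems.AllWindowsColdBox.assembly_proof (prover) · by planner
sources: BrydgesFrohlichSeiler1979, FrohlichIsraelLiebSimon1978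
[assembly] BoxAllWindowsSU22 → BulkWindowSU2 → XiSuperPolySU2 (the deciding theorem closes, proved
in glue_v3: A ↦ window (2A, θ) with 2A < θ ≤ 14A, massGapPowerDecayOf_of_box, ε = 2A/2 = A). -/
@[route_item "route-QuantumFields-AllWindowsColdBox"]
def Assembly : Prop :=
  Summit.QuantumFields.YangMills.Theses.AllWindowsColdBox.BoxAllWindowsSU22 → Summit.QuantumFields.YangMills.Theses.AllWindowsColdBox.BulkWindowSU2 → Summit.QuantumFields.YangMills.Theses.AllWindowsColdBox.XiSuperPolySU2

-- `Assembly` holds: proved by `Summit.QuantumFields.YangMills.Theorems.AllWindowsColdBox.assembly_proof` (its module imports this route file, so no `_holds` link can be stated here).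

/-! D-0027 §2.1 — DECIDING THEOREM (planner-authored via `route open/edit --closes-file`; by planner-ym-idea-2-g0-0 2026-08-27T22:04:04Z):
its hypotheses are this route's items and its conclusion the sub-problem Statement (glue_lint), and it elaborates with this file. -/

@[closes "route-QuantumFields-AllWindowsColdBox"] theorem closes (h₁ : Summit.QuantumFields.YangMills.Theses.AllWindowsColdBox.BoxAllWindowsSU22) (h₂ : Summit.QuantumFields.YangMills.Theses.AllWindowsColdBox.BulkWindowSU2) : Summit.QuantumFields.YangMills.Theses.AllWindowsColdBox.XiSuperPolySU2 := by
  intro A hA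
  obtain ⟨θ, hAθ, hθ7, hbulk⟩ := h₂ (2 * A) (by linarith)
  obtain ⟨c, hc, hbox⟩ := h₁ (2 * A) θ (by linarith) hAθ hθ7
  have h := Summit.QuantumFields.YangMills.Theorems.WeakCouplingRates.massGapPowerDecayOf_of_box
    (G := Matrix.specialUnitaryGroup (Fin 2) ℂ) (Literature.MathematicalPhysics.QuantumLattice.fundamentalRep (Fin 2))
    (Literature.MathematicalPhysics.QuantumLattice.continuous_fundamentalRep (Fin 2)) (by linarith : (0 : ℝ) < 2 * A) hc hbox hbulk
    Summit.QuantumFields.YangMills.Theorems.WeakCouplingRates.curvatureCorrPowerFloor_proof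
  have e : 2 * A / 2 = A := by ring
  rw [e] at h
  exact h

end Summit.QuantumFields.YangMills.Theses.AllWindowsColdBox
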